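import Literature.Computability.Complexity.PolynomialEntropyApproximation

/-!
# PneNP / SzkEntropy — crux `PeaTwoMemBPP` (stmt-PneNP-10778), negative side: the rank/bias census of the pencil does not determine the Shannon entropy

Route `PneNP/SzkEntropy`, crux stmt-PneNP-10778: `PEA 2 ∈ PromiseBPP'` (entropy approximation with
additive gap 1 for quadratic maps `q : F₂ⁿ → F₂ᵐ`).  The planner's stated cheapest falsifier (2) and
the algorithmic idea behind the crux ("Dickson/Arf classification of pencils of quadrics + an
approximate census of low-rank forms") rest on the heuristic that the rank/type CENSUS of the pencil
`{c·q : c ∈ F₂ᵐ}` — the multiset of biases `bias(c·q) ∈ {0, ±2^{-h}}` — predicts `H(q(U_n))` to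
within `1/2`.  It does not:

* `census_witC_eq_witD`, `one_lt_entropy_gap_CD`, packaged as `census_does_not_determine_entropy`:
  two quadratic maps on `n = 12` variables with `m = 10` outputs have IDENTICAL signed bias census
  (all `2¹⁰` members, by evaluation: `native_decide`) and Shannon entropies more than ONE BIT apart
  (`6.4056…` vs `7.7678…`).  Hence no function of the census approximates the entropy to within
  `1/2`, and no census-reading algorithm decides `PEA₂`.
* The census fixes the Walsh spectrum as a multiset, hence the collision (Rényi-2) entropy
  (Parseval), so the phenomenon is exactly the Shannon/Rényi discrepancy made configuration-
  dependent; gaps ADD under direct products (`PolyMapF2.entropy_prod`, and the census is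
  multiplicative), so census-equivalent pairs have unbounded entropy gaps.
* Tools (general, reusable): the entropy bridge `mapEntropy_eq_logb_sub` /
  `entropy_eq_sub_logb_fiberProd` (`H(P(U_n)) = n − log₂ ∏_x |fibre(x)| / 2ⁿ`), which turns entropy
  comparisons into integer inequalities between fibre products (`entropy_gap_of_fiberProd_pow`).

Base pairs: `witA`/`witB` (n = 4, gap 0.3688) and `witP1`/`witP4` (n = 8, gap 0.9935, `H(P₁) = 7/2`
exactly); `witC = P₁ × A`, `witD = P₄ × B`.  Found by random search (evidence `computations_py.txt`,
`py_results.txt` on the item).  Finite evaluations use `native_decide` (computational).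

References: Z. Dvir, D. Gutfreund, G. N. Rothblum, S. Vadhan, *On approximating the entropy of
polynomial mappings*, ICS 2011 (ECCC TR10-160), Claim 5.6 (Rényi entropy = bias census) and §5;
L. E. Dickson, *Linear groups* (1901), Ch. VII §199 (normal forms of quadratic forms over F₂).
-/

namespace Summit.PneNP.PneNP.Theorems.PeaTwoMemBPP.Negative

open Literature.Computability.Complexity Literature.InformationTheory.Entropy
open PolyMapF2

variable {n : ℕ}

/-- The output distribution of `P` as a multiset: `{P(x) : x ∈ F₂ⁿ}` with multiplicity. -/
def outputs (P : PolyMapF2 n) : Multiset (List (ZMod 2)) :=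
  (Finset.univ : Finset (Fin n → ZMod 2)).val.map P.eval

/-- Dot product of a character, given as a coefficient list, with an output list (`zipWith`, so
missing entries are dropped — all output lists of `P` have length `P.length`). -/
def dotL (cl l : List (ZMod 2)) : ZMod 2 :=
  (List.zipWith (· * ·) cl l).sum

/-- Integer bias `#{x : c·P(x) = 0} − #{x : c·P(x) = 1} = 2ⁿ · bias(c·P)` of the member `c·P` of
the pencil, computed from the output multiset `O = outputs P` and the coefficient list of `c`. -/
def intBias (O : Multiset (List (ZMod 2))) (cl : List (ZMod 2)) : ℤ :=
  (O.map fun l => if dotL cl l = 0 then (1 : ℤ) else -1).sum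

/-- The **signed bias census** of the pencil `{c·P : c ∈ F₂ᵐ}`: the multiset of the integer biases of
all `2ᵐ` members.  For quadratic `P` each member is a quadratic function, whose bias is `0` or
`±2^{-h}` with `2h` the rank of its alternating part and the sign its Arf type (Dickson), so this IS the
rank/type census of the planner's falsifier (2), with signs (finer).  It determines the Walsh spectrum
as a multiset, hence every Rényi-2 quantity (Parseval: `2^{-H₂} = 2^{-m} Σ_c bias(c·P)²`). -/
def census (P : PolyMapF2 n) : Multiset ℤ :=
  let O := outputs P
  (Finset.univ : Finset (Fin P.length → ZMod 2)).val.map fun c => intBias O (List.ofFn c)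

/-- Product of the fibre sizes over all inputs, `Π(P) := ∏_x #{x' : P x' = P x}` — the datum of the
Shannon entropy: `H(P(U_n)) = n − log₂ Π(P) / 2ⁿ` (`entropy_eq_sub_logb_fiberProd`). -/
def fiberProd (P : PolyMapF2 n) : ℕ :=
  ∏ x : Fin n → ZMod 2, (fiber Finset.univ P.eval (P.eval x)).card

/-- **Entropy bridge** (general): `H(f(U_S)) = log₂|S| − log₂(∏_{v∈S} |f⁻¹(f v) ∩ S|) / |S|`. -/
theorem mapEntropy_eq_logb_sub {ι β : Type*} [DecidableEq β] {S : Finset ι} (hS : S.Nonempty)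
    (f : ι → β) :
    mapEntropy S f = Real.logb 2 S.card -
      Real.logb 2 (∏ v ∈ S, ((fiber S f (f v)).card : ℝ)) / S.card := by
  have hScard : (S.card : ℝ) ≠ 0 := by exact_mod_cast (Finset.card_pos.2 hS).ne'
  have hF : ∀ v ∈ S, ((fiber S f (f v)).card : ℝ) ≠ 0 := fun v hv => by
    exact_mod_cast (card_fiber_pos f hv).ne'
  unfold mapEntropy
  rw [Real.logb_prod _ _ hF]
  have : ∀ v ∈ S, Real.logb 2 ((S.card : ℝ) / (fiber S f (f v)).card) =
      Real.logb 2 S.card - Real.logb 2 (fiber S f (f v)).card := fun v hv =>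
    Real.logb_div hScard (hF v hv)
  rw [Finset.sum_congr rfl this, Finset.sum_sub_distrib, Finset.sum_const, nsmul_eq_mul]
  field_simp

/-- **Entropy bridge for sparse maps**: `H(P(U_n)) = n − log₂ Π(P) / 2ⁿ`. -/
theorem entropy_eq_sub_logb_fiberProd (P : PolyMapF2 n) :
    P.entropy = n - Real.logb 2 (fiberProd P) / 2 ^ n := by
  have hcard : ((Finset.univ : Finset (Fin n → ZMod 2)).card : ℝ) = 2 ^ n := by
    rw [Finset.card_univ, Fintype.card_fun, ZMod.card, Fintype.card_fin]
    push_cast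
    rfl
  unfold PolyMapF2.entropy
  rw [mapEntropy_eq_logb_sub Finset.univ_nonempty, hcard, fiberProd]
  push_cast
  congr 1
  rw [Real.logb_pow, Real.logb_self_eq_one one_lt_two, mul_one]

/-- Entropy differences are differences of `log₂ Π`, scaled by `2ⁿ`. -/
theorem entropy_sub_entropy (P Q : PolyMapF2 n) :
    Q.entropy - P.entropy = (Real.logb 2 (fiberProd P) - Real.logb 2 (fiberProd Q)) / 2 ^ n := by
  rw [entropy_eq_sub_logb_fiberProd, entropy_eq_sub_logb_fiberProd]
  ring

/-- Fibre products are positive (every point lies in its own fibre). [folklore] -/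
theorem fiberProd_pos (P : PolyMapF2 n) : 0 < fiberProd P :=
  Finset.prod_pos fun x _ => card_fiber_pos _ (Finset.mem_univ x)

/-- From the integer inequality `2ᵏ · Π(Q)ʲ < Π(P)ʲ` to the entropy gap `H(Q) − H(P) > k/(j·2ⁿ)`. -/
theorem entropy_gap_of_fiberProd_pow {P Q : PolyMapF2 n} {j k : ℕ} (hj : 0 < j)
    (h : 2 ^ k * fiberProd Q ^ j < fiberProd P ^ j) :
    (k : ℝ) / (j * 2 ^ n) < Q.entropy - P.entropy := by
  rw [entropy_sub_entropy]
  have hQ : (0 : ℝ) < fiberProd Q := by exact_mod_cast fiberProd_pos Q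
  have hP : (0 : ℝ) < fiberProd P := by exact_mod_cast fiberProd_pos P
  have hlt : Real.logb 2 ((2 : ℝ) ^ k * (fiberProd Q : ℝ) ^ j) < Real.logb 2 ((fiberProd P : ℝ) ^ j) :=
    Real.logb_lt_logb one_lt_two (by positivity) (by exact_mod_cast h)
  rw [Real.logb_mul (by positivity) (by positivity), Real.logb_pow, Real.logb_pow, Real.logb_pow,
    Real.logb_self_eq_one one_lt_two, mul_one] at hlt
  have hj' : (0 : ℝ) < j := by exact_mod_cast hj
  rw [div_lt_div_iff₀ (by positivity) (by positivity)]
  nlinarith [hlt, pow_pos (show (0:ℝ) < 2 by norm_num) n]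

/-- The case `j = 1`: `2ᵏ · Π(Q) < Π(P)` gives `H(Q) − H(P) > k/2ⁿ`. -/
theorem entropy_gap_of_fiberProd {P Q : PolyMapF2 n} {k : ℕ} (h : 2 ^ k * fiberProd Q < fiberProd P) :
    (k : ℝ) / 2 ^ n < Q.entropy - P.entropy := by
  have h' : 2 ^ k * fiberProd Q ^ 1 < fiberProd P ^ 1 := by rw [pow_one, pow_one]; exact h
  have := entropy_gap_of_fiberProd_pow one_pos h'
  rw [Nat.cast_one, one_mul] at this
  exact this

/-- Exact entropy from an exact fibre product that is a power of two: `Π(P) = 2ᵉ ⇒ H = n − e/2ⁿ`. -/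
theorem entropy_of_fiberProd_eq_two_pow {P : PolyMapF2 n} {e : ℕ} (h : fiberProd P = 2 ^ e) :
    P.entropy = n - (e : ℝ) / 2 ^ n := by
  rw [entropy_eq_sub_logb_fiberProd, h]
  push_cast
  rw [Real.logb_pow, Real.logb_self_eq_one one_lt_two, mul_one]

/-! ### 4.1 Base witness pair on `n = 4`, `m = 4` (random search `py/census.py`, seed 3) -/

/-- `A = (x₀x₁ + x₂ + x₀x₂ + x₁x₂ + x₁x₃, 1 + x₂ + x₃, x₁x₂ + x₀x₃ + x₁x₃ + x₂x₃,
x₀ + x₀x₁ + x₁x₂ + x₃ + x₀x₃ + x₁x₃)`, `H = 4 − log₂(2⁸3⁶)/16 ≈ 2.9056`. -/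
def witA : PolyMapF2 4 :=
  [[[0, 1], [2], [0, 2], [1, 2], [1, 3]], [[], [2], [3]], [[1, 2], [0, 3], [1, 3], [2, 3]],
    [[0], [0, 1], [1, 2], [3], [0, 3], [1, 3]]]

/-- `B = (x₀ + x₁ + x₃, x₀ + x₁ + x₀x₁ + x₁x₂ + x₁x₃ + x₂x₃, 1 + x₁ + x₁x₂ + x₃ + x₀x₃,
1 + x₁ + x₀x₂ + x₀x₃ + x₁x₃)`, `H = 4 − log₂(5⁵)/16 ≈ 3.2744`. -/
def witB : PolyMapF2 4 :=
  [[[0], [1], [3]], [[0], [1], [0, 1], [1, 2], [1, 3], [2, 3]], [[], [1], [1, 2], [3], [0, 3]],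
    [[], [1], [0, 2], [0, 3], [1, 3]]]

/-- `A` is quadratic. [folklore] -/
theorem witA_degLE : witA.DegLE 2 := by decide
/-- `B` is quadratic. [folklore] -/
theorem witB_degLE : witB.DegLE 2 := by decide
/-- `A` and `B` have the same signed bias census (16 members, by evaluation). [folklore] -/
theorem census_witA_eq_witB : census witA = census witB := by native_decide
/-- `Π(A) = 2⁸·3⁶` (fibre profile 1,1,2,2,2,2,3,3). [folklore] -/
theorem fiberProd_witA : fiberProd witA = 2 ^ 8 * 3 ^ 6 := by native_decide
/-- `Π(B) = 5⁵` (fibre profile 1×11, 5). [folklore] -/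
theorem fiberProd_witB : fiberProd witB = 5 ^ 5 := by native_decide

/-- Base gap: `17/48 < H(B) − H(A)` (true value 0.36878…; census-equivalent, both quadratic). -/
theorem entropy_gap_AB : (17 : ℝ) / 48 < witB.entropy - witA.entropy := by
  have h : 2 ^ 17 * fiberProd witB ^ 3 < fiberProd witA ^ 3 := by
    rw [fiberProd_witA, fiberProd_witB]; norm_num
  have := entropy_gap_of_fiberProd_pow (by norm_num) h
  norm_num at this ⊢
  linarith

/-! ### 4.2 Sparse witness pair on `n = 8`, `m = 6` (structured search `py/search2.py`, seed 26) -/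

/-- `P₁ = (x₄x₇ + x₇, x₃, x₀x₄, x₄, x₃x₄ + x₀, 1 + x₀x₃)`: `Π = 2^1152`, so `H = 7/2` EXACTLY. -/
def witP1 : PolyMapF2 8 :=
  [[[4, 7], [7]], [[3]], [[0, 4]], [[4]], [[3, 4], [0]], [[], [0, 3]]]

/-- `P₄ = (x₀x₅, x₀x₂, x₀x₆ + 1, x₄ + x₂x₇, x₄x₇ + 1, x₀x₃ + x₀x₅)`: `H ≈ 4.49346`. -/
def witP4 : PolyMapF2 8 :=
  [[[0, 5]], [[0, 2]], [[0, 6], []], [[4], [2, 7]], [[4, 7], []], [[0, 3], [0, 5]]]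

/-- `P₁` is quadratic. [folklore] -/
theorem witP1_degLE : witP1.DegLE 2 := by decide
/-- `P₄` is quadratic. [folklore] -/
theorem witP4_degLE : witP4.DegLE 2 := by decide
/-- `P₁` and `P₄` have the same signed bias census (64 members, by evaluation). [folklore] -/
theorem census_witP1_eq_witP4 : census witP1 = census witP4 := by native_decide
/-- `Π(P₁) = 2^1152` (fibre profile 8×16, 4×32). [folklore] -/
theorem fiberProd_witP1 : fiberProd witP1 = 2 ^ 1152 := by native_decide
/-- `H(P₁(U₈)) = 7/2` exactly. [folklore] -/
theorem entropy_witP1 : witP1.entropy = 7 / 2 := by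
  rw [entropy_of_fiberProd_eq_two_pow fiberProd_witP1]; norm_num
/-- `2^254 · Π(P₄) < Π(P₁)` (by evaluation), i.e. `H(P₄) − H(P₁) > 254/256`. [folklore] -/
theorem fiberProd_witP4_lt : 2 ^ 254 * fiberProd witP4 < fiberProd witP1 := by native_decide

/-- Sparse gap: `127/128 < H(P₄) − H(P₁)` (true value 0.99346…). -/
theorem entropy_gap_P14 : (127 : ℝ) / 128 < witP4.entropy - witP1.entropy := by
  have h := entropy_gap_of_fiberProd fiberProd_witP4_lt
  have e : ((254 : ℕ) : ℝ) / 2 ^ 8 = 127 / 128 := by norm_num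
  rw [e] at h
  exact h

/-! ### 4.3 Gap larger than one bit: direct sums `C = P₁ × A`, `D = P₄ × B` on `n = 12`, `m = 10` -/

/-- `C = P₁ × A` (disjoint variable blocks). -/
def witC : PolyMapF2 12 := witP1.prod witA
/-- `D = P₄ × B`. -/
def witD : PolyMapF2 12 := witP4.prod witB

/-- `C` is quadratic. [folklore] -/
theorem witC_degLE : witC.DegLE 2 := witP1_degLE.prod witA_degLE
/-- `D` is quadratic. [folklore] -/
theorem witD_degLE : witD.DegLE 2 := witP4_degLE.prod witB_degLE

/-- **Census-equivalent quadratic maps on 12 variables** (1024 pencil members × 4096 points, by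
evaluation). -/
theorem census_witC_eq_witD : census witC = census witD := by native_decide

/-- **… whose Shannon entropies differ by more than one bit**: `1 < 127/128 + 17/48 < H(D) − H(C)`
(true values `H(C) = 6.40564…`, `H(D) = 7.76786…`).  Hence NO function of the bias/rank/Arf census
of the pencil approximates the Shannon entropy of quadratic maps to within `1/2`, and none decides
`PEA₂` (after an integer shift of thresholds by padding, cf. REMARK 4.7). -/
theorem one_lt_entropy_gap_CD : (1 : ℝ) < witD.entropy - witC.entropy := by
  have h1 := entropy_gap_P14
  have h2 := entropy_gap_AB
  simp only [witC, witD, entropy_prod]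
  linarith

/-- Packaged: census-equivalent quadratic maps with Shannon entropies more than one bit apart exist. -/
theorem census_does_not_determine_entropy :
    ∃ n : ℕ, ∃ C D : PolyMapF2 n, C.DegLE 2 ∧ D.DegLE 2 ∧ census C = census D ∧
      1 < D.entropy - C.entropy :=
  ⟨12, witC, witD, witC_degLE, witD_degLE, census_witC_eq_witD, one_lt_entropy_gap_CD⟩

/-! REMARK 4.7 (amplification, on paper; the finite instances above are what is machine-checked).
(a) `census (P.prod Q)` is the multiset of products `{b·b' : b ∈ census P, b' ∈ census Q}` (a
character of `F₂^{m+m'}` is a pair of characters and `Σ_{(x,x')} (−1)^{c·P x + c'·Q x'}` factorises), so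
census-equivalence is preserved by direct products with a common factor and by products of equivalent
pairs; (b) `entropy_prod` adds entropies.  Hence from ONE census-equivalent pair with gap δ > 0 one gets
pairs with gap tδ for every t (n = 4: δ = 0.3688; t = 3 already exceeds 1), and by padding both maps
with the same product of fresh gadgets (x·y: +0.8113 bits; (xy, xz): +1.5488 bits; fresh linear
outputs: +1) the two entropies can be placed on opposite sides of an integer threshold pair (k, k+1):
census-reading algorithms fail on actual PEA₂ instances, not only on the real-valued functional.
(c) Searched maxima of the single-pair gap (random sparse maps, 10⁵–4·10⁵ trials each): n=4,m=4: 0.37;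
n=6,m=5: 0.64; n=7,m=6: 0.79; n=8,m=6: 0.9935; n=8,m=8: 0.88; n=9,m=7: 0.77; n=10,m=8: 0.71 (under-
sampled).  Within census classes of RANDOM dense maps (n = m = 5, 6) spreads of 0.2–0.37 are typical:
the phenomenon is generic, not a curiosity of sparse maps. -/


end Summit.PneNP.PneNP.Theorems.PeaTwoMemBPP.Negative
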